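import Mathlib
import HarnessLib
import Summits.HubbardSuperconductivity.HubbardSuperconductivity.Theorems.KLProgrammeKLRegimeTwoVolumeTowerStepCovZeroPlainSymbol

/-!
# K3 VL child `KLRegimeVolumeLimitV17F2` (stmt-HubbardSuperconductivity-20440), located item «SCALE-0-STEPCOV», part 2c (PLAIN `ℓ¹`, SECTIONAL): the ISOTROPIC
# moment-weighted FIXED-TIME `ℓ¹` norm of the plain slice kernel `(βV²)⁻²·Ψ̂_{(Λ₂,Λ₁]}[K]` at ONE admissible frame with `‖D³e_K‖ ≤ K₃` is `≤ C_e(K₃)` (ε-free)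

Cell `gate-hubbard-kl`, seat p3 (g17).  With part 1's reduction `secRowWt_klStepCov_zero_le'` this is `ScaleCovSecData (klStepCov V M β μ K 0) …` at a frame whose
band has a volume-free third derivative (the BASE frame of the flow telescope, part 4):

* **`plainSlice_wt_sectional_le (K₃)`** — `∃ C_e, s₁ > 0` (`s₁ ≤ 1`) such that on any lattice, at any frame with `FrameOK R U N μ K` and `‖D³e_K‖ ≤ K₃`, for
  `klBetaMin ≤ β`, at EVERY time difference `z₁`:
  `Σ_{z₂} (1 + s₁|z̃₂,₁| + s₁|z̃₂,₂|)·‖Σ_q χ_{q₁}(z₁)χ_{q₂}(z₂) • (βV²)⁻²Ψ̂_{(Λ₂,Λ₁]}(ω(q₁), e_K(q₂))‖ ≤ C_e`.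
  Proof: k3c3-p2's `sliceCharSumWt_sectional_le_of_mixed_data` with the symbol itself as the «multiplier» (`Mf := Ψ̂`, `Ψ := 1`), `v = e₂`, `R₀ = 0`, the same
  spatial rate `s₁(K₃)` as part 2b (orders three AND two along `v`), time support `≤ Λ₁β/π + 3 ≤ β(Λ₁/π + 3/128)` (`card_filter_matsubaraFreq_le`) against the
  amplitude `4/(βV²Λ₂)`, spatial support `≤ (1793Λ₁ + 704)V²` (`card_frameLevel_le_le`) against `√(24V²·N_sp)`: β and V cancel.

Everything is proved; no definitions, no sorry.  Nothing asserts any stub, K3, VL or superconductivity.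
[cite: BenfattoGiulianiMastropietro2006, Lemma 2.2 (2.52)–(2.55), §2.7 (2.66)–(2.67), §2.8 (2.80)–(2.81)]
-/

noncomputable section

namespace Summit.HubbardSuperconductivity.HubbardSuperconductivity.Theorems.TorusFourierL2

set_option linter.dupNamespace false -- summit = problem name (single-conjunct summit), D-0017

open Set Finset Literature.MathematicalPhysics.QuantumLattice Literature.MathematicalPhysics.QuantumLattice.BandSectorCounting
open Literature.MathematicalPhysics.QuantumLattice.FermiRG Literature.Probability.LatticeModels Literature.Analysis.SpecialFunctions
open Summit.HubbardSuperconductivity.HubbardSuperconductivity.Theorems.DispersionFlow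
open Summit.HubbardSuperconductivity.HubbardSuperconductivity.Theorems.KLRegimeSplit
open Summit.HubbardSuperconductivity.HubbardSuperconductivity.Theorems.KLProgrammeLegKernels
open Summit.HubbardSuperconductivity.HubbardSuperconductivity.Theorems.PerturbedFermiCurve
open Summit.HubbardSuperconductivity.HubbardSuperconductivity.Theorems.KLRegimeWick
open Summit.HubbardSuperconductivity.HubbardSuperconductivity.Theorems.TwoVolumeSource
open scoped Real Nat

open Classical

/-! ## §3 The sectional (fixed-time) weighted `ℓ¹` norm at one admissible frame -/

section Sectional

set_option maxHeartbeats 4000000 in -- explicit-constant bookkeeping against the large sectional master lemma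
/-- **THE SECTIONAL ISOTROPIC WEIGHTED `ℓ¹` BOUND OF THE PLAIN SLICE KERNEL AT ONE ADMISSIBLE FRAME** (ε-free): for every `K₃ ≥ 0` there are `C_e, s₁ > 0`
(`s₁ ≤ 1`) such that on any lattice, at any frame with `FrameOK R U N μ K` and `‖D³e_K‖ ≤ K₃`, for `klBetaMin ≤ β`, at EVERY time difference `z₁`,
`Σ_{z₂} (1 + s₁|z̃₂,₁| + s₁|z̃₂,₂|)·‖Σ_q χ_{q₁}(z₁)χ_{q₂}(z₂) • (βV²)⁻²Ψ̂_{(Λ₂,Λ₁]}(ω(q₁), e_K(q₂))‖ ≤ C_e`.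
[cite: BenfattoGiulianiMastropietro2006, Lemma 2.2 (2.52)–(2.55), §2.8 (2.80)–(2.81)] -/
theorem plainSlice_wt_sectional_le (K₃ : ℝ) (hK₃ : 0 ≤ K₃) :
    ∃ Ce s₁ : ℝ, 0 < Ce ∧ 0 < s₁ ∧ s₁ ≤ 1 ∧
      ∀ (V M : ℕ) [NeZero V] [NeZero M] (R : RenConsts) (U : ℝ) (N : ℕ) (μ : ℝ) (K : TrigPolyC4v), FrameOK R U N μ K →
      (∀ p, ‖iteratedFDeriv ℝ 3 (frameLevel μ K) p‖ ≤ K₃) →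
      ∀ β : ℝ, klBetaMin ≤ β →
        ∀ z₁ : TorusSite 1 (2 * M), ∑ z₂ : TorusSite 2 V,
          (1 + s₁ * |(((z₂ 0).valMinAbs : ℤ) : ℝ)| + s₁ * |(((z₂ 1).valMinAbs : ℤ) : ℝ)|) *
            ‖∑ q : TorusSite 1 (2 * M) × TorusSite 2 V, (torusChar q.1 z₁ * torusChar q.2 z₂) •
              ((((1 / (β * (V : ℝ) ^ 2) : ℝ) : ℂ) ^ 2 *
                sliceSymbolFnXi (β * (V : ℝ) ^ 2) 0 (klScale klE0 2) (klScale klE0 1) (matsubaraFreq β M ⟨(q.1 0).val, ZMod.val_lt (q.1 0)⟩)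
                  (nambuXiCT V μ K q.2)))‖ ≤ Ce := by
  -- the cutoff numerals and the slice constants
  set D₁ : ℝ := 16 * (32 / 3 : ℝ) + 16 with hD₁
  set D₂ : ℝ := 32 * (448 / 3 * Real.exp 2) + 144 * (32 / 3 : ℝ) + 128 with hD₂
  set D₃ : ℝ := 64 * (44900 : ℝ) + 480 * (448 / 3 * Real.exp 2) + 1728 * (32 / 3 : ℝ) + 1536 with hD₃
  have hD₁0 : 0 < D₁ := by rw [hD₁]; norm_num
  have hD₂0 : 0 < D₂ := by rw [hD₂]; positivity
  have hD₃0 : 0 < D₃ := by rw [hD₃]; positivity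
  have he : (0 : ℝ) < klE0 := by norm_num [klE0]
  set Λ₂ : ℝ := klScale klE0 2 with hΛ₂def
  set Λ₁ : ℝ := klScale klE0 1 with hΛ₁def
  have hΛ2 : 0 < Λ₂ := klth_klScale_pos 2
  have hΛ1 : 0 < Λ₁ := klth_klScale_pos 1
  have hΛ21 : Λ₂ ≤ Λ₁ := EngineV8.klScale_le_klScale he.le (by norm_num)
  have hΛ1t : Λ₁ < 3 / 80 := klScale_klE0_lt_tube 1
  have hπ := Real.pi_pos
  -- the spatial polynomials and the spatial rate
  set X₂ : ℝ := D₂ * (7 + 28 * π) ^ 2 / Λ₂ ^ 3 + 7 * D₁ / Λ₂ ^ 2 with hX₂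
  set X₃ : ℝ := D₃ * (7 + 42 * π) ^ 3 / Λ₂ ^ 4 + 21 * D₂ * (7 + 42 * π) / Λ₂ ^ 3 + D₁ * K₃ / Λ₂ ^ 2 with hX₃
  set X : ℝ := X₂ + X₃ with hX
  have hX₂0 : 0 ≤ X₂ := by rw [hX₂]; positivity
  have hX₃0 : 0 ≤ X₃ := by rw [hX₃]; positivity
  have hX0 : 0 ≤ X := by rw [hX]; positivity
  set s₁ : ℝ := 1 / (2 * π * (1 + Λ₂ * X)) with hs₁
  have hs₁0 : 0 < s₁ := by rw [hs₁]; positivity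
  have hs₁1 : s₁ ≤ 1 := by
    rw [hs₁, div_le_one (by positivity)]
    have : 0 ≤ Λ₂ * X := by positivity
    nlinarith [Real.pi_gt_three]
  set CW' : ℝ := 524288 * ((1 : ℝ) + 1) *
      ((1 + 4 * Real.sqrt 2) ^ 2 * ((2 * Real.sqrt 2 / s₁ + 2) * (2 * Real.sqrt 2 / s₁ + 2)) + (1 / s₁ + 1) ^ 2) with hCW'
  have hCW'0 : 0 < CW' := by rw [hCW']; positivity
  refine ⟨(Λ₁ / π + 3 / 128) * (Real.sqrt CW' * Real.sqrt (24 * (1793 * Λ₁ + 704)) * (4 / Λ₂)), s₁, by positivity, hs₁0, hs₁1, ?_⟩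
  intro V M _ _ R U N μ K hK hK3 β hβmin z₁
  -- the instance
  have hβ0 : 0 < β := pos_of_klBetaMin_le hβmin
  have hβ128 : (128 : ℝ) ≤ β := by simpa [klBetaMin] using hβmin
  have hV1 : (1 : ℝ) ≤ V := by exact_mod_cast Nat.pos_of_ne_zero (NeZero.ne V)
  have hV0 : (0 : ℝ) < V := by linarith
  have hc : 0 < β * (V : ℝ) ^ 2 := by positivity
  obtain ⟨hre, hrn, hrv, hv⟩ := unitDirs_sq
  -- abbreviations
  set c₀ : ℂ := (((1 / (β * (V : ℝ) ^ 2) : ℝ) : ℂ)) ^ 2 with hc₀def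
  set Ψ : TorusSite 1 (2 * M) × TorusSite 2 V → ℂ := fun q =>
    sliceSymbolFnXi (β * (V : ℝ) ^ 2) 0 Λ₂ Λ₁ (matsubaraFreq β M ⟨(q.1 0).val, ZMod.val_lt (q.1 0)⟩) (nambuXiCT V μ K q.2) with hΨdef
  set A₀ : ℝ := (1 / (β * (V : ℝ) ^ 2)) ^ 2 * (4 * (β * (V : ℝ) ^ 2) / Λ₂) with hA₀def
  have hA₀0 : 0 ≤ A₀ := by positivity
  have hA₀eq : A₀ = 4 / (β * (V : ℝ) ^ 2 * Λ₂) := by rw [hA₀def]; field_simp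
  -- (a) sup
  have hsup : ∀ q, ‖c₀ * Ψ q‖ ≤ A₀ := fun q => plainSymbol_sup_le (V := V) (M := M) hβ0 μ K q
  -- (b) rate identities
  have key3 : X₃ ≤ 256 * (1 + Λ₂ * X) ^ 3 / Λ₂ := by
    rw [le_div_iff₀ hΛ2]
    have h0 : 0 ≤ Λ₂ * X₂ := mul_nonneg hΛ2.le hX₂0
    have h1 : X₃ * Λ₂ ≤ 1 + Λ₂ * X := by rw [hX, mul_add]; linarith [mul_comm X₃ Λ₂]
    have h2 : (1 : ℝ) ≤ 1 + Λ₂ * X := by linarith [mul_nonneg hΛ2.le hX0]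
    have h3 : 1 + Λ₂ * X ≤ (1 + Λ₂ * X) ^ 3 := le_self_pow₀ h2 (by norm_num)
    have h4 : 0 ≤ (1 + Λ₂ * X) ^ 3 := by positivity
    linarith
  have key2 : X₂ ≤ 64 * (1 + Λ₂ * X) ^ 2 / Λ₂ := by
    rw [le_div_iff₀ hΛ2]
    have h0 : 0 ≤ Λ₂ * X₃ := mul_nonneg hΛ2.le hX₃0
    have h1 : X₂ * Λ₂ ≤ 1 + Λ₂ * X := by rw [hX, mul_add]; linarith [mul_comm X₂ Λ₂]
    have h2 : (1 : ℝ) ≤ 1 + Λ₂ * X := by linarith [mul_nonneg hΛ2.le hX0]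
    have h3 : 1 + Λ₂ * X ≤ (1 + Λ₂ * X) ^ 2 := le_self_pow₀ h2 (by norm_num)
    have h4 : 0 ≤ (1 + Λ₂ * X) ^ 2 := by positivity
    linarith
  have hsV3 : (4 / (s₁ * V)) ^ 3 = (2 * π / V) ^ 3 * (64 * (1 + Λ₂ * X) ^ 3) := by
    rw [hs₁]; field_simp; ring
  have hsV2 : (4 / (s₁ * V)) ^ 2 = (2 * π / V) ^ 2 * (16 * (1 + Λ₂ * X) ^ 2) := by
    rw [hs₁]; field_simp; ring
  -- (c) the spatial inputs (orders three and two)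
  have hspace3 : ∀ r : Fin 2 → ℤ, (r 0 : ℝ) ^ 2 + (r 1 : ℝ) ^ 2 = 1 → ∀ q,
      ‖((fwdDiff ((0 : TorusSite 1 (2 * M)), (fun i => ((r i : ℤ) : ZMod V))))^[3] (fun y => c₀ * Ψ y)) q‖ ≤ A₀ * (4 / (s₁ * V)) ^ 3 := by
    intro r hr q
    refine (plainSymbol_three_space_le (V := V) (M := M) hK hβ0 hK3 r hr q).trans ?_
    conv_rhs => rw [hA₀def, mul_assoc]
    refine mul_le_mul_of_nonneg_left ?_ (by positivity)
    rw [← hD₃, ← hD₂, ← hD₁, ← hΛ₂def, ← hX₃, hsV3]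
    have : β * (V : ℝ) ^ 2 * (2 * π / V) ^ 3 * X₃ ≤ β * (V : ℝ) ^ 2 * (2 * π / V) ^ 3 * (256 * (1 + Λ₂ * X) ^ 3 / Λ₂) :=
      mul_le_mul_of_nonneg_left key3 (by positivity)
    refine this.trans (le_of_eq ?_)
    field_simp
    ring
  have hspace2 : ∀ r : Fin 2 → ℤ, (r 0 : ℝ) ^ 2 + (r 1 : ℝ) ^ 2 = 1 → ∀ q,
      ‖((fwdDiff ((0 : TorusSite 1 (2 * M)), (fun i => ((r i : ℤ) : ZMod V))))^[2] (fun y => c₀ * Ψ y)) q‖ ≤ A₀ * (4 / (s₁ * V)) ^ 2 := by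
    intro r hr q
    refine (plainSymbol_two_space_le (V := V) (M := M) hK hβ0 r hr q).trans ?_
    conv_rhs => rw [hA₀def, mul_assoc]
    refine mul_le_mul_of_nonneg_left ?_ (by positivity)
    rw [← hD₂, ← hD₁, ← hΛ₂def, ← hX₂, hsV2]
    have : β * (V : ℝ) ^ 2 * (2 * π / V) ^ 2 * X₂ ≤ β * (V : ℝ) ^ 2 * (2 * π / V) ^ 2 * (64 * (1 + Λ₂ * X) ^ 2 / Λ₂) :=
      mul_le_mul_of_nonneg_left key2 (by positivity)
    refine this.trans (le_of_eq ?_)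
    field_simp
    ring
  -- (d) time and spatial support of the symbol
  have hsuppT : ((univ : Finset (TorusSite 1 (2 * M))).filter fun q₁ => ∃ k, Ψ (q₁, k) ≠ 0).card ≤
      ((univ : Finset (TorusSite 1 (2 * M))).filter fun q₁ => ∃ k, Ψ (q₁, k) ≠ 0).card := le_rfl
  have hNt : ((((univ : Finset (TorusSite 1 (2 * M))).filter fun q₁ => ∃ k, Ψ (q₁, k) ≠ 0).card : ℕ) : ℝ) ≤ β * (Λ₁ / π + 3 / 128) := by
    have hsub : ((univ : Finset (TorusSite 1 (2 * M))).filter fun q₁ => ∃ k, Ψ (q₁, k) ≠ 0) ⊆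
        (univ : Finset (TorusSite 1 (2 * M))).filter fun q₁ =>
          (fun i : MatsubaraIdx M => |matsubaraFreq β M i| ≤ Λ₁) ⟨(q₁ 0).val, ZMod.val_lt (q₁ 0)⟩ := by
      intro q₁ hq
      rw [mem_filter] at hq ⊢
      obtain ⟨k, hk⟩ := hq.2
      refine ⟨mem_univ _, ?_⟩
      by_contra hω
      exact hk (sliceSymbolFnXi_eq_zero_of_not_shell hΛ2 hΛ21 (fun h => hω h.1))
    have h1 := (Finset.card_le_card hsub).trans (card_filter_timeTorus_le_card_filter (M := M) (fun i : MatsubaraIdx M => |matsubaraFreq β M i| ≤ Λ₁))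
    have h2 : ((((univ : Finset (MatsubaraIdx M)).filter fun i => |matsubaraFreq β M i| ≤ Λ₁).card : ℕ) : ℝ) ≤ Λ₁ * β / π + 3 :=
      card_filter_matsubaraFreq_le hβ0 hΛ1.le _ fun i hi => (mem_filter.1 hi).2
    refine le_trans (Nat.cast_le.2 h1) (h2.trans ?_)
    rw [mul_add]
    have : (3 : ℝ) ≤ β * (3 / 128) := by linarith
    have e : Λ₁ * β / π = β * (Λ₁ / π) := by ring
    linarith
  have hsuppS : ∀ q₁ : TorusSite 1 (2 * M), ((univ : Finset (TorusSite 2 V)).filter fun k => Ψ (q₁, k) ≠ 0).card ≤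
      ((univ : Finset (TorusSite 2 V)).filter fun k => |nambuXiCT V μ K k| ≤ Λ₁).card := by
    intro q₁
    refine Finset.card_le_card fun k hk => ?_
    rw [mem_filter] at hk ⊢
    refine ⟨hk.1, ?_⟩
    by_contra he'
    exact hk.2 (sliceSymbolFnXi_eq_zero_of_not_shell hΛ2 hΛ21 (fun h => he' h.2))
  have hNsp : ((((univ : Finset (TorusSite 2 V)).filter fun k => |nambuXiCT V μ K k| ≤ Λ₁).card : ℕ) : ℝ) ≤ (V : ℝ) ^ 2 * (1793 * Λ₁ + 704) := by
    refine (card_frameLevel_le_le hK hΛ1.le hΛ1t).trans ?_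
    have hVV : (V : ℝ) ≤ (V : ℝ) ^ 2 := le_self_pow₀ hV1 (by norm_num)
    have e : (V : ℝ) ^ 2 * (1793 * Λ₁ + 704) = 1793 * Λ₁ * (V : ℝ) ^ 2 + 704 * (V : ℝ) ^ 2 := by ring
    rw [e]; linarith
  -- (e) the sectional master lemma with the symbol as the «multiplier» and `1` as the «propagator»
  have hfun : (fun y : TorusSite 1 (2 * M) × TorusSite 2 V => c₀ * (Ψ y * (fun _ : TorusSite 1 (2 * M) × TorusSite 2 V => (1 : ℂ)) y)) =
      fun y => c₀ * Ψ y := by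
    funext y; simp only [mul_one]
  have h₁ : ∀ q (i : Fin 2), ‖((fwdDiff ((0 : TorusSite 1 (2 * M)), (Pi.single i (1 : ZMod V) : TorusSite 2 V)))^[3]
      (fun y : TorusSite 1 (2 * M) × TorusSite 2 V => c₀ * (Ψ y * (fun _ : TorusSite 1 (2 * M) × TorusSite 2 V => (1 : ℂ)) y))) q‖ ≤
      A₀ * (4 / (s₁ * V)) ^ 3 := fun q i => by
    rw [hfun, pi_single_zmod_eq_intCast V i]; exact hspace3 _ (hre i) q
  have h₂ : ∀ q, ‖((fwdDiff ((0 : TorusSite 1 (2 * M)), (fun j => (((![-(![0, 1] : Fin 2 → ℤ) 1, (![0, 1] : Fin 2 → ℤ) 0] : Fin 2 → ℤ) j : ℤ) : ZMod V))))^[3]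
      (fun y : TorusSite 1 (2 * M) × TorusSite 2 V => c₀ * (Ψ y * (fun _ : TorusSite 1 (2 * M) × TorusSite 2 V => (1 : ℂ)) y))) q‖ ≤
      A₀ * (4 / (s₁ * V)) ^ 3 := fun q => by
    rw [hfun]; exact hspace3 _ hrn q
  have h₃ : ∀ q, ‖((fwdDiff ((0 : TorusSite 1 (2 * M)), (fun j => (((![0, 1] : Fin 2 → ℤ) j : ℤ) : ZMod V))))^[2]
      (fun y : TorusSite 1 (2 * M) × TorusSite 2 V => c₀ * (Ψ y * (fun _ : TorusSite 1 (2 * M) × TorusSite 2 V => (1 : ℂ)) y))) q‖ ≤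
      A₀ * (4 / (s₁ * V)) ^ 2 := fun q => by
    rw [hfun]; exact hspace2 _ hrv q
  have h₃' : ∀ q, ‖((fwdDiff ((0 : TorusSite 1 (2 * M)), (fun j => (((![0, 1] : Fin 2 → ℤ) j : ℤ) : ZMod V))))^[3]
      (fun y : TorusSite 1 (2 * M) × TorusSite 2 V => c₀ * (Ψ y * (fun _ : TorusSite 1 (2 * M) × TorusSite 2 V => (1 : ℂ)) y))) q‖ ≤
      A₀ * (4 / (s₁ * V)) ^ 3 := fun q => by
    rw [hfun]; exact hspace3 _ hrv q
  have hsup' : ∀ q, ‖c₀ * (Ψ q * (fun _ : TorusSite 1 (2 * M) × TorusSite 2 V => (1 : ℂ)) q)‖ ≤ A₀ := fun q => by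
    simp only [mul_one]; exact hsup q
  have main := sliceCharSumWt_sectional_le_of_mixed_data c₀ Ψ (fun _ => (1 : ℂ)) (![0, 1] : Fin 2 → ℤ) hv (s₀ := 1) one_pos hs₁0 hs₁0 hs₁0 hs₁0
    (R₀ := 0) (by push_cast; rw [mul_zero]; exact_mod_cast Nat.pos_of_ne_zero (NeZero.ne V)) hA₀0 hsuppT hsuppS hsup' h₁ h₂ h₃ h₃' z₁
  simp only [mul_one] at main
  refine main.trans ?_
  have hv0 : (((![0, 1] : Fin 2 → ℤ) 0 : ℤ) : ℝ) = 0 := by simp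
  have hv1 : (((![0, 1] : Fin 2 → ℤ) 1 : ℤ) : ℝ) = 1 := by simp
  rw [hv0, hv1]
  have hsq1 : Real.sqrt ((0 : ℝ) ^ 2 + (1 : ℝ) ^ 2) = 1 := by norm_num
  rw [hsq1]
  have es : 2 * Real.sqrt 2 * s₁ / (s₁ * 1) = 2 * Real.sqrt 2 := by field_simp
  rw [es, Nat.cast_zero, mul_zero, add_zero, div_one, div_one, mul_one]
  have e2 : (1 + 2 * Real.sqrt 2 + 2 * Real.sqrt 2) = 1 + 4 * Real.sqrt 2 := by ring
  rw [e2, ← hCW']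
  have hNsq : Real.sqrt (24 * (V : ℝ) ^ 2 * ((((univ : Finset (TorusSite 2 V)).filter fun k => |nambuXiCT V μ K k| ≤ Λ₁).card : ℕ) : ℝ)) ≤
      (V : ℝ) ^ 2 * Real.sqrt (24 * (1793 * Λ₁ + 704)) := by
    have e : Real.sqrt ((V : ℝ) ^ 4 * (24 * (1793 * Λ₁ + 704))) = (V : ℝ) ^ 2 * Real.sqrt (24 * (1793 * Λ₁ + 704)) := by
      rw [show (V : ℝ) ^ 4 * (24 * (1793 * Λ₁ + 704)) = (((V : ℝ) ^ 2) ^ 2) * (24 * (1793 * Λ₁ + 704)) by ring,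
        Real.sqrt_mul (by positivity) (24 * (1793 * Λ₁ + 704)), Real.sqrt_sq (by positivity)]
    rw [← e]; refine Real.sqrt_le_sqrt ?_
    have := mul_le_mul_of_nonneg_left hNsp (by positivity : (0 : ℝ) ≤ 24 * (V : ℝ) ^ 2)
    linarith
  calc ((((univ : Finset (TorusSite 1 (2 * M))).filter fun q₁ => ∃ k, Ψ (q₁, k) ≠ 0).card : ℕ) : ℝ) *
        (Real.sqrt CW' * Real.sqrt (24 * (V : ℝ) ^ 2 * ((((univ : Finset (TorusSite 2 V)).filter fun k => |nambuXiCT V μ K k| ≤ Λ₁).card : ℕ) : ℝ)) * A₀)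
      ≤ (β * (Λ₁ / π + 3 / 128)) * (Real.sqrt CW' * ((V : ℝ) ^ 2 * Real.sqrt (24 * (1793 * Λ₁ + 704))) * A₀) := by gcongr
    _ = (Λ₁ / π + 3 / 128) * (Real.sqrt CW' * Real.sqrt (24 * (1793 * Λ₁ + 704)) * (4 / Λ₂)) := by
        rw [hA₀eq]; field_simp

end Sectional

end Summit.HubbardSuperconductivity.HubbardSuperconductivity.Theorems.TorusFourierL2

end
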